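import Mathlib
import Literature.Combinatorics.Optimization.RandomPairMultigraphPruned
import HarnessLib

/-!
# Random sparse multigraphs, IV: the CMM gap graphs exist (pointwise assembly)

[topic Combinatorics/Optimization]

Fourth file toward `CharikarMakarychevMakarychev2009_gapGraphs`: for given numeric parameters
satisfying explicit inequalities, some outcome `ω` of the random pair multigraph avoids all six bad
events (a large cut, many loops, many repeated pairs, many high-degree incidences, many indices on
short closed tuples, a locally dense vertex set), by the union bound of
`RandomPairMultigraphCuts`/`Sparsity` ("with high probability … modulo a few small alterations",
[AroraBollobasLovaszTourlakis2006] Lemma 2.8, [CharikarMakarychevMakarychev2009] p. 10); its pruned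
edge set (`RandomPairMultigraphPruned`) then has the five properties of the named fact
(`exists_good_pruned`), the path decomposability coming from `pathDecomposable_of_sparse`
([AroraBollobasLovaszTourlakis2006] Lemma 2.12).  The choice of the parameters as functions of `ε`
and `n → ∞` is the last file.  Everything is proved; no named facts.

## References

* [AroraBollobasLovaszTourlakis2006] Theory of Computing 2 (2006), Lemma 2.8 (p. 26–27), Lemma 2.12.
* [CharikarMakarychevMakarychev2009] STOC 2009, §5 p. 10–11.
-/

noncomputable section

open Finset Real Filter Topology

namespace Literature.Combinatorics.Optimization

namespace RandomPairs

variable {n M : ℕ}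

/-- The threshold `r(W) = ⌊(1+η)|W|⌋ + 1` of the local density event. [cite: AroraBollobasLovaszTourlakis2006, Lemma 2.8 (p. 26: "(1+η)ℓ edges")] -/
def rThr (η : ℝ) (W : Finset (Fin n)) : ℕ := ⌊(1 + η) * W.card⌋₊ + 1

/-- The small vertex sets: `|W| ≤ K`. [cite: AroraBollobasLovaszTourlakis2006, Lemma 2.8 (p. 26: "ℓ ≤ βn vertices")] -/
def smallSets (n K : ℕ) : Finset (Finset (Fin n)) := (univ : Finset (Fin n)).powerset.filter fun W => W.card ≤ K

/-- **A good outcome**: none of the six bad events. [cite: AroraBollobasLovaszTourlakis2006, Lemma 2.8 proof (p. 26–27)] -/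
def Good (ε₁ : ℝ) (lam D l K : ℕ) (η : ℝ) (ω : Fin M → Fin n × Fin n) : Prop :=
  (∀ x : Fin n → Bool, (cutCount x ω : ℝ) < (1 / 2 + ε₁ / 4) * M) ∧
  (loopCount ω : ℝ) < 8 * lam ∧
  (repCount ω : ℝ) < 16 * (lam : ℝ) ^ 2 ∧
  (highInc D ω : ℝ) < ε₁ * M / 64 ∧
  ((cycIdx l ω).card : ℝ) < ε₁ * M / 64 ∧
  (∀ W ∈ smallSets n K, inCount W ω < rThr η W)

section Bounds

variable {ε₁ : ℝ} {lam D l K : ℕ} {η : ℝ}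

/-- Powers of `n²`: `(n²)^M = n² (n²)^{M−1} = (n²)² (n²)^{M−2}` for `M ≥ 2`. [folklore] -/
private theorem pow_split (hM2 : 2 ≤ M) :
    ((n * n : ℕ) : ℝ) ^ M = ((n : ℝ) * n) * ((n : ℝ) * n) ^ (M - 1) ∧
    ((n * n : ℕ) : ℝ) ^ M = ((n : ℝ) * n) ^ 2 * ((n : ℝ) * n) ^ (M - 2) := by
  constructor
  · push_cast; rw [← pow_succ', Nat.sub_add_cancel (by omega)]
  · push_cast; rw [← pow_add]; congr 1; omega

/-- (1) **Large cuts are rare**: `≤ N/8`. [cite: CharikarMakarychevMakarychev2009, §5 (p. 10)] -/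
theorem card_badCut_le (hε₁ : 0 < ε₁) (hn : 2 ≤ n) (hM : M = lam * n) (hlam16 : 16 ≤ ε₁ ^ 2 * lam) :
    ((((univ : Finset (Fin M → Fin n × Fin n)).filter fun ω =>
        ∃ x : Fin n → Bool, (1 / 2 + ε₁ / 4) * M ≤ (cutCount x ω : ℝ)).card : ℝ)) ≤
      ((n * n : ℕ) : ℝ) ^ M / 8 := by
  set N : ℝ := ((n * n : ℕ) : ℝ) ^ M with hN
  have hNpos : 0 ≤ N := by rw [hN]; positivity
  have hMr : (M : ℝ) = lam * n := by rw [hM]; push_cast; ring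
  have hnpos : (0 : ℝ) ≤ n := Nat.cast_nonneg _
  refine (card_exists_cut_ge_le (n := n) (M := M) (ε := ε₁ / 4) (by linarith)).trans ?_
  rw [← hN]
  have hexp : exp (-(2 * (ε₁ / 4) ^ 2 * M)) ≤ exp (-(2 * n)) := by
    rw [exp_le_exp, hMr]
    have : (16 : ℝ) * n ≤ ε₁ ^ 2 * lam * n := by nlinarith
    nlinarith
  have h2e : (2 : ℝ) * exp (-2) ≤ 3 / 10 := by
    have he : exp (1 : ℝ) > 2.7182818283 := exp_one_gt_d9
    have h22 : exp (2 : ℝ) = exp 1 * exp 1 := by rw [← exp_add]; norm_num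
    have h2 : exp (2 : ℝ) ≥ 20 / 3 := by rw [h22]; nlinarith
    rw [exp_neg, mul_inv_le_iff₀ (exp_pos _)]; linarith
  have hpow : (2 : ℝ) ^ n * exp (-(2 * n)) ≤ 1 / 8 := by
    have : (2 : ℝ) ^ n * exp (-(2 * n)) = (2 * exp (-2)) ^ n := by
      rw [mul_pow, ← Real.exp_nat_mul]; ring_nf
    rw [this]
    calc (2 * exp (-2) : ℝ) ^ n ≤ (3 / 10) ^ n := pow_le_pow_left₀ (by positivity) h2e n
      _ ≤ (3 / 10) ^ 2 := pow_le_pow_of_le_one (by norm_num) (by norm_num) hn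
      _ ≤ 1 / 8 := by norm_num
  calc (2 : ℝ) ^ n * (N * exp (-(2 * (ε₁ / 4) ^ 2 * M))) ≤ 2 ^ n * (N * exp (-(2 * n))) := by gcongr
    _ = (2 ^ n * exp (-(2 * n))) * N := by ring
    _ ≤ 1 / 8 * N := mul_le_mul_of_nonneg_right hpow hNpos
    _ = N / 8 := by ring

/-- (2) **Many loops are rare**: `≤ N/8`. [cite: AroraBollobasLovaszTourlakis2006, Lemma 2.8 proof (p. 26–27)] -/
theorem card_badLoop_le (hn : 2 ≤ n) (hM : M = lam * n) (hlam : 1 ≤ lam) :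
    ((((univ : Finset (Fin M → Fin n × Fin n)).filter fun ω =>
        (8 * lam : ℝ) ≤ (loopCount ω : ℝ)).card : ℝ)) ≤ ((n * n : ℕ) : ℝ) ^ M / 8 := by
  classical
  have hM2 : 2 ≤ M := by rw [hM]; exact le_trans (by norm_num) (Nat.mul_le_mul hlam hn)
  have hMr : (M : ℝ) = lam * n := by rw [hM]; push_cast; ring
  have hlam1 : (1 : ℝ) ≤ lam := by exact_mod_cast hlam
  have hm := card_filter_mul_le_sum (fun ω : Fin M → Fin n × Fin n => (loopCount ω : ℝ))
    (fun _ => Nat.cast_nonneg _) (8 * lam)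
  have hsum : ∑ ω : Fin M → Fin n × Fin n, (loopCount ω : ℝ) = lam * ((n * n : ℕ) : ℝ) ^ M := by
    have h' : ((∑ ω : Fin M → Fin n × Fin n, loopCount ω : ℕ) : ℝ) =
        ((M * (n * (n * n) ^ (M - 1)) : ℕ) : ℝ) := by rw [sum_loopCount]
    push_cast at h'
    rw [h', hMr, (pow_split hM2).1]; ring
  rw [hsum] at hm
  have hl : (0 : ℝ) < 8 * lam := by linarith
  calc _ ≤ lam * ((n * n : ℕ) : ℝ) ^ M / (8 * lam) := (le_div_iff₀ hl).2 hm
    _ = ((n * n : ℕ) : ℝ) ^ M / 8 := by field_simp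

/-- (3) **Many repeated pairs are rare**: `≤ N/8`. [cite: AroraBollobasLovaszTourlakis2006, Lemma 2.8 proof (p. 26–27)] -/
theorem card_badRep_le (hn : 2 ≤ n) (hM : M = lam * n) (hlam : 1 ≤ lam) :
    ((((univ : Finset (Fin M → Fin n × Fin n)).filter fun ω =>
        (16 * (lam : ℝ) ^ 2) ≤ (repCount ω : ℝ)).card : ℝ)) ≤ ((n * n : ℕ) : ℝ) ^ M / 8 := by
  classical
  have hM2 : 2 ≤ M := by rw [hM]; exact le_trans (by norm_num) (Nat.mul_le_mul hlam hn)
  have hMr : (M : ℝ) = lam * n := by rw [hM]; push_cast; ring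
  have hlam1 : (1 : ℝ) ≤ lam := by exact_mod_cast hlam
  have hm := card_filter_mul_le_sum (fun ω : Fin M → Fin n × Fin n => (repCount ω : ℝ))
    (fun _ => Nat.cast_nonneg _) (16 * (lam : ℝ) ^ 2)
  have hsum : ∑ ω : Fin M → Fin n × Fin n, (repCount ω : ℝ) ≤ 2 * lam ^ 2 * ((n * n : ℕ) : ℝ) ^ M := by
    have h' : ((∑ ω : Fin M → Fin n × Fin n, repCount ω : ℕ) : ℝ) ≤
        ((M * M * (2 * (n * n) * (n * n) ^ (M - 2)) : ℕ) : ℝ) := by exact_mod_cast sum_repCount_le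
    push_cast at h'
    refine h'.trans (le_of_eq ?_)
    rw [hMr, (pow_split hM2).2]; ring
  have hl : (0 : ℝ) < 16 * (lam : ℝ) ^ 2 := by positivity
  calc _ ≤ 2 * lam ^ 2 * ((n * n : ℕ) : ℝ) ^ M / (16 * lam ^ 2) := (le_div_iff₀ hl).2 (hm.trans hsum)
    _ = ((n * n : ℕ) : ℝ) ^ M / 8 := by field_simp; ring

/-- (4) **Many high-degree incidences are rare**: `≤ N/8`. [cite: CharikarMakarychevMakarychev2009, §5 (p. 11); AroraBollobasLovaszTourlakis2006, Lemma 2.8 proof] -/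
theorem card_badHigh_le (hε₁ : 0 < ε₁) (hn : 2 ≤ n) (hM : M = lam * n) (hlam : 1 ≤ lam)
    (hD : 512 * (2 + 4 * (lam : ℝ)) ≤ D * ε₁) :
    ((((univ : Finset (Fin M → Fin n × Fin n)).filter fun ω =>
        ε₁ * M / 64 ≤ (highInc D ω : ℝ)).card : ℝ)) ≤ ((n * n : ℕ) : ℝ) ^ M / 8 := by
  classical
  set N : ℝ := ((n * n : ℕ) : ℝ) ^ M with hN
  set C : ℝ := (((univ : Finset (Fin M → Fin n × Fin n)).filter fun ω =>
        ε₁ * M / 64 ≤ (highInc D ω : ℝ)).card : ℝ) with hC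
  have hM2 : 2 ≤ M := by rw [hM]; exact le_trans (by norm_num) (Nat.mul_le_mul hlam hn)
  have hMr : (M : ℝ) = lam * n := by rw [hM]; push_cast; ring
  have hlam1 : (1 : ℝ) ≤ lam := by exact_mod_cast hlam
  have hnpos : (0 : ℝ) < n := by exact_mod_cast (by omega : 0 < n)
  have hNpos : 0 ≤ N := by rw [hN]; positivity
  have hm := card_filter_mul_le_sum (fun ω : Fin M → Fin n × Fin n => (highInc D ω : ℝ))
    (fun _ => Nat.cast_nonneg _) (ε₁ * M / 64)
  rw [← hC] at hm
  have hsum : (D : ℝ) * ∑ ω : Fin M → Fin n × Fin n, (highInc D ω : ℝ) ≤ n * (2 * lam + 4 * lam ^ 2) * N := by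
    have h' : ((D * ∑ ω : Fin M → Fin n × Fin n, highInc D ω : ℕ) : ℝ) ≤
        ((n * (M * (2 * n * (n * n) ^ (M - 1)) + M * M * ((2 * n) ^ 2 * (n * n) ^ (M - 2))) : ℕ) : ℝ) := by
      exact_mod_cast mul_sum_highInc_le (n := n) (M := M) D
    push_cast at h'
    refine h'.trans (le_of_eq ?_)
    have e1 := (pow_split (n := n) hM2).1
    have e2 := (pow_split (n := n) hM2).2
    rw [← hN] at e1 e2
    rw [hMr]
    have : (n : ℝ) * (↑lam * ↑n * (2 * ↑n * (↑n * ↑n) ^ (M - 1)) + ↑lam * ↑n * (↑lam * ↑n) * ((2 * ↑n) ^ 2 * (↑n * ↑n) ^ (M - 2)))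
        = n * (2 * lam) * (↑n * ↑n * (↑n * ↑n) ^ (M - 1)) + n * (4 * lam ^ 2) * ((↑n * ↑n) ^ 2 * (↑n * ↑n) ^ (M - 2)) := by ring
    rw [this, ← e1, ← e2]; ring
  have hDε : (0 : ℝ) < D * ε₁ := lt_of_lt_of_le (by positivity) hD
  have hDpos : (0 : ℝ) < D := pos_of_mul_pos_left hDε hε₁.le  -- hmm order
  have hprod : C * (ε₁ * M / 64) * D ≤ n * (2 * lam + 4 * lam ^ 2) * N := by
    calc C * (ε₁ * M / 64) * D ≤ (∑ ω : Fin M → Fin n × Fin n, (highInc D ω : ℝ)) * D :=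
          mul_le_mul_of_nonneg_right hm hDpos.le
      _ = D * ∑ ω : Fin M → Fin n × Fin n, (highInc D ω : ℝ) := by ring
      _ ≤ _ := hsum
  rw [hMr] at hprod
  have hC0 : 0 ≤ C := by rw [hC]; exact Nat.cast_nonneg _
  -- `C · Dε₁ · λ n ≤ 64 (2+4λ) N · λ n`
  have key : C * (D * ε₁) ≤ 64 * (2 + 4 * lam) * N := by
    have h1 : C * (D * ε₁) * (lam * n) ≤ 64 * (2 + 4 * lam) * N * (lam * n) := by
      have e : (n : ℝ) * (2 * lam + 4 * lam ^ 2) * N = (2 + 4 * lam) * N * (lam * n) := by ring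
      nlinarith
    exact le_of_mul_le_mul_right h1 (by positivity)
  have key2 : C * (512 * (2 + 4 * lam)) ≤ 64 * (2 + 4 * lam) * N :=
    (mul_le_mul_of_nonneg_left hD hC0).trans key
  have h24 : (0 : ℝ) < 2 + 4 * lam := by positivity
  have : C * 512 ≤ 64 * N := le_of_mul_le_mul_right (by nlinarith) h24
  linarith

/-- (5) **Many indices on short closed tuples are rare**: `≤ N/8`. [cite: AroraBollobasLovaszTourlakis2006, Lemma 2.8 proof (p. 27)] -/
theorem card_badCyc_le (hε₁ : 0 < ε₁) (hn : 2 ≤ n) (hM : M = lam * n) (hlam : 1 ≤ lam)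
    (hcyc : 512 * ((l : ℝ) + 1) ^ 2 * (2 * lam) ^ l ≤ ε₁ * lam * n) (hlM : l ≤ M) :
    ((((univ : Finset (Fin M → Fin n × Fin n)).filter fun ω =>
        ε₁ * M / 64 ≤ ((cycIdx l ω).card : ℝ)).card : ℝ)) ≤ ((n * n : ℕ) : ℝ) ^ M / 8 := by
  classical
  set N : ℝ := ((n * n : ℕ) : ℝ) ^ M with hN
  set C : ℝ := (((univ : Finset (Fin M → Fin n × Fin n)).filter fun ω =>
        ε₁ * M / 64 ≤ ((cycIdx l ω).card : ℝ)).card : ℝ) with hC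
  have hMr : (M : ℝ) = lam * n := by rw [hM]; push_cast; ring
  have hlam1 : (1 : ℝ) ≤ lam := by exact_mod_cast hlam
  have hnpos : (0 : ℝ) < n := by exact_mod_cast (by omega : 0 < n)
  have hNpos : 0 ≤ N := by rw [hN]; positivity
  have hm := card_filter_mul_le_sum (fun ω : Fin M → Fin n × Fin n => ((cycIdx l ω).card : ℝ))
    (fun _ => Nat.cast_nonneg _) (ε₁ * M / 64)
  rw [← hC] at hm
  -- `Σ_ω #circuits_j ≤ (2λ)^j N`
  have hcirc : ∀ j, j ≤ l → ∑ ω : Fin M → Fin n × Fin n, ((circuits j ω).card : ℝ) ≤ (2 * lam) ^ j * N := by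
    intro j hjl
    have hs' : ((∑ ω : Fin M → Fin n × Fin n, (circuits j ω).card : ℕ) : ℝ) ≤
        ((M ^ j * n ^ j * (2 ^ j * (n * n) ^ (M - j)) : ℕ) : ℝ) := by
      exact_mod_cast sum_card_circuits_le (n := n) (M := M) j
    push_cast at hs'
    refine hs'.trans (le_of_eq ?_)
    have hpowj : ((n : ℝ) * n) ^ (M - j) * ((n : ℝ) * n) ^ j = N := by
      rw [← pow_add, Nat.sub_add_cancel (hjl.trans hlM), hN]; push_cast; ring
    rw [← hpowj, hMr]; ring
  have hsum : ∑ ω : Fin M → Fin n × Fin n, ((cycIdx l ω).card : ℝ) ≤ ((l : ℝ) + 1) ^ 2 * (2 * lam) ^ l * N := by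
    have hω : ∀ ω : Fin M → Fin n × Fin n, ((cycIdx l ω).card : ℝ) ≤
        ∑ j ∈ range (l + 1), (j : ℝ) * (circuits j ω).card := by
      intro ω
      have := card_cycIdx_le (n := n) (M := M) l ω
      have h' : (((cycIdx l ω).card : ℕ) : ℝ) ≤ ((∑ j ∈ range (l + 1), j * (circuits j ω).card : ℕ) : ℝ) := by
        exact_mod_cast this
      push_cast at h'
      exact h'
    refine (sum_le_sum fun ω _ => hω ω).trans ?_
    rw [Finset.sum_comm]
    have h2l : (1 : ℝ) ≤ 2 * lam := by linarith
    have hl0 : (0 : ℝ) ≤ l := Nat.cast_nonneg _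
    have hj : ∀ j ∈ range (l + 1), ∑ ω : Fin M → Fin n × Fin n, (j : ℝ) * (circuits j ω).card ≤
        (l : ℝ) * ((2 * lam) ^ l * N) := by
      intro j hjr
      have hjl : j ≤ l := by have := mem_range.1 hjr; omega
      rw [← Finset.mul_sum]
      have hsum0 : (0 : ℝ) ≤ ∑ ω : Fin M → Fin n × Fin n, ((circuits j ω).card : ℝ) :=
        Finset.sum_nonneg fun _ _ => Nat.cast_nonneg _
      have hjr' : (j : ℝ) ≤ l := by exact_mod_cast hjl
      have hpowle : (2 * (lam : ℝ)) ^ j ≤ (2 * lam) ^ l := pow_le_pow_right₀ h2l hjl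
      have step1 : (j : ℝ) * ∑ ω : Fin M → Fin n × Fin n, ((circuits j ω).card : ℝ) ≤
          l * ∑ ω : Fin M → Fin n × Fin n, ((circuits j ω).card : ℝ) := mul_le_mul_of_nonneg_right hjr' hsum0
      have step2 : (l : ℝ) * ∑ ω : Fin M → Fin n × Fin n, ((circuits j ω).card : ℝ) ≤ l * ((2 * lam) ^ j * N) :=
        mul_le_mul_of_nonneg_left (hcirc j hjl) hl0
      have step3 : (l : ℝ) * ((2 * lam) ^ j * N) ≤ l * ((2 * lam) ^ l * N) :=
        mul_le_mul_of_nonneg_left (mul_le_mul_of_nonneg_right hpowle hNpos) hl0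
      exact step1.trans (step2.trans step3)
    calc _ ≤ ∑ _j ∈ range (l + 1), (l : ℝ) * ((2 * lam) ^ l * N) := sum_le_sum hj
      _ = (l + 1) * ((l : ℝ) * ((2 * lam) ^ l * N)) := by
          rw [sum_const, card_range, nsmul_eq_mul]; push_cast; ring
      _ ≤ ((l : ℝ) + 1) ^ 2 * (2 * lam) ^ l * N := by
          have : (0 : ℝ) ≤ (2 * lam) ^ l * N := mul_nonneg (pow_nonneg (by linarith) _) hNpos
          nlinarith
  have hle : C * (ε₁ * M / 64) ≤ ((l : ℝ) + 1) ^ 2 * (2 * lam) ^ l * N := hm.trans hsum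
  rw [hMr] at hle
  have hC0 : 0 ≤ C := by rw [hC]; exact Nat.cast_nonneg _
  have h1 : C * (ε₁ * (lam * n)) ≤ 64 * (((l : ℝ) + 1) ^ 2 * (2 * lam) ^ l) * N := by nlinarith
  have h2 : 64 * (((l : ℝ) + 1) ^ 2 * (2 * lam) ^ l) * N * 8 ≤ (ε₁ * lam * n) * N := by nlinarith
  have hpos : (0 : ℝ) < ε₁ * (lam * n) := by positivity
  have h3 : C * (ε₁ * (lam * n)) * 8 ≤ (ε₁ * (lam * n)) * N := by nlinarith
  have h4 : C * 8 ≤ N := le_of_mul_le_mul_right (by nlinarith) hpos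
  linarith

/-- (6) **A locally dense small set is rare**: `≤ N/8`, granted the bound on the union-bound sum.
[cite: AroraBollobasLovaszTourlakis2006, Lemma 2.8 proof (p. 27)] -/
theorem card_badDense_le
    (hdense : (∑ W ∈ smallSets n K, (M.choose (rThr η W) *
        ((W.card * W.card) ^ (rThr η W) * (n * n) ^ (M - rThr η W)) : ℝ)) ≤ ((n * n : ℕ) : ℝ) ^ M / 8) :
    ((((univ : Finset (Fin M → Fin n × Fin n)).filter fun ω =>
        ∃ W ∈ smallSets n K, rThr η W ≤ inCount W ω).card : ℝ)) ≤ ((n * n : ℕ) : ℝ) ^ M / 8 := by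
  classical
  have h' : ((((univ : Finset (Fin M → Fin n × Fin n)).filter fun ω =>
        ∃ W ∈ smallSets n K, rThr η W ≤ inCount W ω).card : ℝ)) ≤
      ((∑ W ∈ smallSets n K, M.choose (rThr η W) *
        ((W.card * W.card) ^ (rThr η W) * (n * n) ^ (M - rThr η W)) : ℕ) : ℝ) := by
    exact_mod_cast card_exists_dense_le (n := n) (M := M) (smallSets n K) (rThr η)
  push_cast at h' hdense ⊢
  exact h'.trans hdense

end Bounds

/-- **Union bound: a good outcome exists** when each bad event has at most `1/8` of the outcomes.
[cite: AroraBollobasLovaszTourlakis2006, Lemma 2.8 proof (p. 26–27); CharikarMakarychevMakarychev2009, §5 (p. 10)] -/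
theorem exists_good {ε₁ : ℝ} (hε₁ : 0 < ε₁) {lam D l K : ℕ} {η : ℝ} (hn : 2 ≤ n) (hM : M = lam * n)
    (hlam : 1 ≤ lam) (hlam16 : 16 ≤ ε₁ ^ 2 * lam) (hD : 512 * (2 + 4 * (lam : ℝ)) ≤ D * ε₁)
    (hcyc : 512 * ((l : ℝ) + 1) ^ 2 * (2 * lam) ^ l ≤ ε₁ * lam * n) (hlM : l ≤ M)
    (hdense : (∑ W ∈ smallSets n K, (M.choose (rThr η W) *
        ((W.card * W.card) ^ (rThr η W) * (n * n) ^ (M - rThr η W)) : ℝ)) ≤ ((n * n : ℕ) : ℝ) ^ M / 8) :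
    ∃ ω : Fin M → Fin n × Fin n, Good ε₁ lam D l K η ω := by
  classical
  have h1 := card_badCut_le (n := n) hε₁ hn hM hlam16
  have h2 := card_badLoop_le (n := n) hn hM hlam
  have h3 := card_badRep_le (n := n) hn hM hlam
  have h4 := card_badHigh_le (n := n) hε₁ hn hM hlam hD
  have h5 := card_badCyc_le (n := n) hε₁ hn hM hlam hcyc hlM
  have h6 := card_badDense_le (n := n) (M := M) (K := K) (η := η) hdense
  set B1 := (univ : Finset (Fin M → Fin n × Fin n)).filter fun ω =>
        ∃ x : Fin n → Bool, (1 / 2 + ε₁ / 4) * M ≤ (cutCount x ω : ℝ) with hB1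
  set B2 := (univ : Finset (Fin M → Fin n × Fin n)).filter fun ω => (8 * lam : ℝ) ≤ (loopCount ω : ℝ) with hB2
  set B3 := (univ : Finset (Fin M → Fin n × Fin n)).filter fun ω => (16 * (lam : ℝ) ^ 2) ≤ (repCount ω : ℝ) with hB3
  set B4 := (univ : Finset (Fin M → Fin n × Fin n)).filter fun ω => ε₁ * M / 64 ≤ (highInc D ω : ℝ) with hB4
  set B5 := (univ : Finset (Fin M → Fin n × Fin n)).filter fun ω => ε₁ * M / 64 ≤ ((cycIdx l ω).card : ℝ) with hB5
  set B6 := (univ : Finset (Fin M → Fin n × Fin n)).filter fun ω =>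
        ∃ W ∈ smallSets n K, rThr η W ≤ inCount W ω with hB6
  set B := B1 ∪ B2 ∪ B3 ∪ B4 ∪ B5 ∪ B6 with hB
  have hN : ((n * n : ℕ) : ℝ) ^ M = Fintype.card (Fin M → Fin n × Fin n) := by
    rw [Fintype.card_fun, Fintype.card_prod, Fintype.card_fin, Fintype.card_fin]; push_cast; ring
  have hBcard : (B.card : ℝ) ≤ B1.card + B2.card + B3.card + B4.card + B5.card + B6.card := by
    have e5 : (B.card : ℝ) ≤ (B1 ∪ B2 ∪ B3 ∪ B4 ∪ B5).card + B6.card := by exact_mod_cast card_union_le _ _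
    have e4 : ((B1 ∪ B2 ∪ B3 ∪ B4 ∪ B5).card : ℝ) ≤ (B1 ∪ B2 ∪ B3 ∪ B4).card + B5.card := by
      exact_mod_cast card_union_le _ _
    have e3 : ((B1 ∪ B2 ∪ B3 ∪ B4).card : ℝ) ≤ (B1 ∪ B2 ∪ B3).card + B4.card := by exact_mod_cast card_union_le _ _
    have e2 : ((B1 ∪ B2 ∪ B3).card : ℝ) ≤ (B1 ∪ B2).card + B3.card := by exact_mod_cast card_union_le _ _
    have e1 : ((B1 ∪ B2).card : ℝ) ≤ B1.card + B2.card := by exact_mod_cast card_union_le _ _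
    linarith
  have hNpos : (0 : ℝ) < ((n * n : ℕ) : ℝ) ^ M := by
    have : (0 : ℝ) < n := by exact_mod_cast (by omega : 0 < n)
    positivity
  have hbad : (B.card : ℝ) < Fintype.card (Fin M → Fin n × Fin n) := by rw [← hN]; linarith
  have hlt : B.card < (univ : Finset (Fin M → Fin n × Fin n)).card := by
    rw [card_univ]; exact_mod_cast hbad
  obtain ⟨ω, -, hω⟩ := exists_mem_notMem_of_card_lt_card hlt
  have hω1 : ω ∉ B1 := fun h => hω (by rw [hB]; exact mem_union_left _ (mem_union_left _ (mem_union_left _ (mem_union_left _ (mem_union_left _ h)))))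
  have hω2 : ω ∉ B2 := fun h => hω (by rw [hB]; exact mem_union_left _ (mem_union_left _ (mem_union_left _ (mem_union_left _ (mem_union_right _ h)))))
  have hω3 : ω ∉ B3 := fun h => hω (by rw [hB]; exact mem_union_left _ (mem_union_left _ (mem_union_left _ (mem_union_right _ h))))
  have hω4 : ω ∉ B4 := fun h => hω (by rw [hB]; exact mem_union_left _ (mem_union_left _ (mem_union_right _ h)))
  have hω5 : ω ∉ B5 := fun h => hω (by rw [hB]; exact mem_union_left _ (mem_union_right _ h))
  have hω6 : ω ∉ B6 := fun h => hω (by rw [hB]; exact mem_union_right _ h)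
  refine ⟨ω, ?_, ?_, ?_, ?_, ?_, ?_⟩
  · intro x
    by_contra h; push Not at h
    exact hω1 (mem_filter.2 ⟨mem_univ _, x, h⟩)
  · by_contra h; push Not at h
    exact hω2 (mem_filter.2 ⟨mem_univ _, h⟩)
  · by_contra h; push Not at h
    exact hω3 (mem_filter.2 ⟨mem_univ _, h⟩)
  · by_contra h; push Not at h
    exact hω4 (mem_filter.2 ⟨mem_univ _, h⟩)
  · by_contra h; push Not at h
    exact hω5 (mem_filter.2 ⟨mem_univ _, h⟩)
  · intro W hW
    by_contra h; push Not at h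
    exact hω6 (mem_filter.2 ⟨mem_univ _, W, hW, h⟩)

/-! ### A good outcome gives a good edge set -/

/-- **The pruned edge set of a good outcome has the five properties** of
`CharikarMakarychevMakarychev2009_gapGraphs` (with `∆ = D`, cut excess `ε₁ ≤ ε`, path length `l`).
[cite: CharikarMakarychevMakarychev2009, §5 (p. 10–11); AroraBollobasLovaszTourlakis2006, Lemma 2.8, Lemma 2.12] -/
theorem good_props {ε ε₁ : ℝ} (hε₁ : 0 < ε₁) (hε₁1 : ε₁ ≤ 1) (hε₁ε : ε₁ ≤ ε) {lam D l K : ℕ} {η : ℝ}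
    (hM : M = lam * n) (hn : 1 ≤ n) (hlam : 1 ≤ lam) (hD1 : 1 ≤ D)
    (hsmall : 32 * (8 * (lam : ℝ) + 16 * lam ^ 2) ≤ ε₁ * M) (hη : η = 1 / (6 * l + 14))
    (hK : (K : ℝ) = ⌊Real.sqrt n⌋₊) {ω : Fin M → Fin n × Fin n} (hω : Good ε₁ lam D l K η ω) :
    (pruned D l ω).Nonempty ∧ (∀ e ∈ pruned D l ω, ¬ e.IsDiag) ∧
      (∀ v : Fin n, ((pruned D l ω).filter fun e => v ∈ e).card ≤ D) ∧
      (∀ x : Fin n → Bool, ∑ e ∈ pruned D l ω, cutFn e x ≤ (1 / 2 + ε) * (pruned D l ω).card) ∧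
      (∀ E' ⊆ pruned D l ω, ((Multicut.supp E').card : ℝ) ^ 2 ≤ n →
        Multicut.PathDecomposable l E') := by
  classical
  obtain ⟨hcut, hloop, hrep, hhigh, hcyc, hdense⟩ := hω
  set E := pruned D l ω with hE
  have hMr : (M : ℝ) = lam * n := by rw [hM]; push_cast; ring
  have hM1 : (1 : ℝ) ≤ M := by
    rw [hMr]; have : (1:ℝ) ≤ lam := by exact_mod_cast hlam
    have : (1:ℝ) ≤ n := by exact_mod_cast hn
    nlinarith
  -- size of the pruned edge set
  have hsize : (1 - ε₁ / 16) * M ≤ (E.card : ℝ) := by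
    have h := le_card_pruned_add (n := n) (M := M) D l ω
    have h' : (M : ℝ) ≤ (E.card : ℝ) + loopCount ω + highInc D ω + (cycIdx l ω).card + repCount ω := by
      exact_mod_cast h
    nlinarith
  have hEpos : (0 : ℝ) < E.card := by nlinarith
  refine ⟨?_, pruned_loopless D l ω, fun v => (edeg_pruned_lt hD1 l ω v).le, fun x => ?_, fun E' hE' hsupp => ?_⟩
  · exact card_pos.1 (by exact_mod_cast hEpos)
  · -- cuts
    refine (sum_cutFn_pruned_le D l ω x).trans ?_
    have h1 := (hcut x).le
    have h2 : (1 / 2 + ε₁ / 4) * (M : ℝ) ≤ (1 / 2 + ε₁) * E.card := by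
      have : (1 / 2 + ε₁ / 4) ≤ (1 / 2 + ε₁) * (1 - ε₁ / 16) := by nlinarith
      calc (1 / 2 + ε₁ / 4) * (M : ℝ) ≤ (1 / 2 + ε₁) * (1 - ε₁ / 16) * M :=
            mul_le_mul_of_nonneg_right this (by linarith)
        _ = (1 / 2 + ε₁) * ((1 - ε₁ / 16) * M) := by ring
        _ ≤ (1 / 2 + ε₁) * E.card := mul_le_mul_of_nonneg_left hsize (by linarith)
    have h3 : (1 / 2 + ε₁) * (E.card : ℝ) ≤ (1 / 2 + ε) * E.card :=
      mul_le_mul_of_nonneg_right (by linarith) hEpos.le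
    linarith
  · -- path decomposability of small sub-edge-sets
    have hloop' : ∀ e ∈ E', ¬ e.IsDiag := fun e he => pruned_loopless D l ω e (hE' he)
    have hηle : η * (6 * l + 14) ≤ 1 := by
      rw [hη]; have : (0 : ℝ) < 6 * l + 14 := by positivity
      rw [div_mul_cancel₀ _ this.ne']
    refine Multicut.pathDecomposable_of_sparse E' hloop' hηle (fun E'' hE'' h2 => ?_)
      (Multicut.girth_mono hE' (girth_pruned D l ω))
    -- sparsity of `E''` from the density event of `W = supp E''`
    set W := Multicut.supp E'' with hW
    have hWK : W.card ≤ K := by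
      have h1 : W.card ≤ (Multicut.supp E').card := card_le_card (Multicut.supp_mono hE'')
      have h2 : ((W.card : ℝ)) ^ 2 ≤ n := le_trans (by exact_mod_cast Nat.pow_le_pow_left h1 2) hsupp
      have h3 : (W.card : ℝ) ≤ Real.sqrt n := by
        rw [← Real.sqrt_sq (Nat.cast_nonneg W.card)]
        exact Real.sqrt_le_sqrt h2
      have : (W.card : ℝ) ≤ K := by
        rw [hK]; exact_mod_cast Nat.le_floor h3
      exact_mod_cast this
    have hWsmall : W ∈ smallSets n K := mem_filter.2 ⟨mem_powerset.2 (subset_univ _), hWK⟩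
    have hin := hdense W hWsmall
    -- `inCount ≤ ⌊(1+η)|W|⌋ ≤ (1+η)|W|`
    have hη0 : 0 ≤ η := by rw [hη]; positivity
    have hin' : (inCount W ω : ℝ) ≤ (1 + η) * W.card := by
      have : inCount W ω ≤ ⌊(1 + η) * W.card⌋₊ := by unfold rThr at hin; omega
      calc (inCount W ω : ℝ) ≤ (⌊(1 + η) * (W.card : ℝ)⌋₊ : ℝ) := by exact_mod_cast this
        _ ≤ (1 + η) * W.card := Nat.floor_le (by positivity)
    -- `|E''| ≤ #{e ∈ E : e ⊆ W} ≤ inCount W ω`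
    have hsub : E'' ⊆ E.filter fun e => ∀ v ∈ e, v ∈ W := by
      intro e he
      refine mem_filter.2 ⟨hE' (hE'' he), fun v hv => ?_⟩
      exact Multicut.mem_supp.2 ⟨e, he, hv⟩
    have hcardle : E''.card ≤ inCount W ω :=
      (card_le_card hsub).trans (card_filter_subset_le_inCount D l ω W)
    calc (E''.card : ℝ) ≤ inCount W ω := by exact_mod_cast hcardle
      _ ≤ (1 + η) * W.card := hin'

/-! ### The local density sum -/

/-- `C(m, k) ≤ (e m / k)^k` for `k ≥ 1` (the standard binomial estimate used in the first-moment
count). [cite: AroraBollobasLovaszTourlakis2006, Lemma 2.8 proof (p. 27)] -/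
theorem choose_le_exp_pow (m : ℕ) {k : ℕ} (hk : 1 ≤ k) :
    ((m.choose k : ℕ) : ℝ) ≤ (exp 1 * m / k) ^ k := by
  have hkpos : (0 : ℝ) < k := by exact_mod_cast hk
  have h1 : ((m.choose k : ℕ) : ℝ) ≤ (m : ℝ) ^ k / (k.factorial : ℝ) := by
    have := Nat.choose_le_pow_div k m (α := ℝ)
    simpa using this
  -- `k^k / k! ≤ e^k`
  have h2 : (k : ℝ) ^ k / (k.factorial : ℝ) ≤ exp 1 ^ k := by
    have := Real.pow_div_factorial_le_exp (x := (k : ℝ)) (Nat.cast_nonneg k) k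
    have e : exp (k : ℝ) = exp 1 ^ k := by rw [← Real.exp_nat_mul, mul_one]
    exact this.trans e.le
  have hfac : (0 : ℝ) < k.factorial := by exact_mod_cast Nat.factorial_pos k
  have hkk : (0 : ℝ) < (k : ℝ) ^ k := pow_pos hkpos k
  calc ((m.choose k : ℕ) : ℝ) ≤ (m : ℝ) ^ k / k.factorial := h1
    _ = (m : ℝ) ^ k / (k : ℝ) ^ k * ((k : ℝ) ^ k / k.factorial) := by field_simp
    _ ≤ (m : ℝ) ^ k / (k : ℝ) ^ k * exp 1 ^ k := mul_le_mul_of_nonneg_left h2 (by positivity)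
    _ = (exp 1 * m / k) ^ k := by rw [← div_pow, ← mul_pow]; ring

/-- `rThr η W = |W| + ⌊η|W|⌋ + 1`. [cite: AroraBollobasLovaszTourlakis2006, Lemma 2.8 (p. 26)] -/
theorem rThr_eq {η : ℝ} (hη : 0 ≤ η) (W : Finset (Fin n)) :
    rThr η W = W.card + ⌊η * W.card⌋₊ + 1 := by
  unfold rThr
  rw [add_mul, one_mul, add_comm ((W.card : ℝ)), Nat.floor_add_natCast (by positivity), add_comm (W.card)]

/-- **The term of one vertex set**: for `1 ≤ |W| ≤ √n`, `eλ ≤ √n`, `M = λn`,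
`C(M,r)(|W|²)^r(n²)^{M−r} ≤ (n²)^M (eλ|W|/n)^{|W|} (ρ^η)^{|W|}` with `r = rThr η W`, `ρ = eλ/√n`.
[cite: AroraBollobasLovaszTourlakis2006, Lemma 2.8 proof (p. 27)] -/
theorem dense_term_le {lam : ℕ} {η : ℝ} (hη0 : 0 ≤ η) (hM : M = lam * n) (hn : 1 ≤ n) (hlam : 1 ≤ lam)
    (hρ : exp 1 * lam ≤ Real.sqrt n) (W : Finset (Fin n)) (hW1 : 1 ≤ W.card)
    (hWn : (W.card : ℝ) ≤ Real.sqrt n) :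
    ((M.choose (rThr η W) : ℕ) : ℝ) * (((W.card : ℝ) * W.card) ^ (rThr η W) * ((n : ℝ) * n) ^ (M - rThr η W)) ≤
      ((n : ℝ) * n) ^ M * ((exp 1 * lam * W.card / n) ^ W.card *
        ((exp 1 * lam / Real.sqrt n) ^ η) ^ W.card) := by
  set w := W.card with hw
  set r := rThr η W with hr
  set q := ⌊η * w⌋₊ with hq
  have hrq : r = w + q + 1 := by rw [hr, rThr_eq hη0, ← hw]
  have hnpos : (0 : ℝ) < n := by exact_mod_cast (by omega : 0 < n)
  have hwpos : (0 : ℝ) < w := by exact_mod_cast (by omega : 0 < w)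
  have hlam1 : (1 : ℝ) ≤ lam := by exact_mod_cast hlam
  have hsqrt : 0 < Real.sqrt n := Real.sqrt_pos.2 hnpos
  have hsq : Real.sqrt n * Real.sqrt n = n := Real.mul_self_sqrt hnpos.le
  set ρ : ℝ := exp 1 * lam / Real.sqrt n with hρdef
  have hρpos : 0 < ρ := by rw [hρdef]; positivity
  have hρ1 : ρ ≤ 1 := by rw [hρdef, div_le_one hsqrt]; exact hρ
  have hr1 : 1 ≤ r := by rw [hrq]; omega
  by_cases hrM : M < r
  · rw [Nat.choose_eq_zero_of_lt hrM]; simp only [Nat.cast_zero, zero_mul]; positivity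
  push Not at hrM
  -- `C(M,r) ≤ (eM/r)^r` and `(n²)^{M-r} (n²)^r = (n²)^M`
  have hC := choose_le_exp_pow M hr1
  have hpow : ((n : ℝ) * n) ^ (M - r) * ((n : ℝ) * n) ^ r = ((n : ℝ) * n) ^ M := by
    rw [← pow_add, Nat.sub_add_cancel hrM]
  have hrpos : (0 : ℝ) < r := by exact_mod_cast hr1
  have hwr : (w : ℝ) ≤ r := by exact_mod_cast (by omega : w ≤ r)
  -- main chain
  have step1 : ((M.choose r : ℕ) : ℝ) * (((w : ℝ) * w) ^ r * ((n : ℝ) * n) ^ (M - r)) ≤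
      ((n : ℝ) * n) ^ M * (exp 1 * lam * w / n) ^ r := by
    have hMr : (M : ℝ) = lam * n := by rw [hM]; push_cast; ring
    -- `(eM/r)^r (w²)^r (n²)^{M-r} = (n²)^M (e λ w² /(r n))^r ≤ (n²)^M (eλ w/n)^r`
    have e1 : (exp 1 * M / r) ^ r * (((w : ℝ) * w) ^ r * ((n : ℝ) * n) ^ (M - r)) =
        ((n : ℝ) * n) ^ M * (exp 1 * lam * (w * w) / (r * n)) ^ r := by
      rw [← hpow, hMr]
      have : (exp 1 * (lam * n) / r) ^ r * (((w : ℝ) * w) ^ r * ((n : ℝ) * n) ^ (M - r)) =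
          ((n : ℝ) * n) ^ (M - r) * ((exp 1 * (lam * n) / r) * (w * w)) ^ r := by rw [mul_pow]; ring
      rw [this, mul_assoc, ← mul_pow]
      congr 2
      field_simp
    have e2 : exp 1 * lam * ((w : ℝ) * w) / (r * n) ≤ exp 1 * lam * w / n := by
      rw [div_le_div_iff₀ (by positivity) hnpos]
      have e : exp 1 * lam * ((w : ℝ) * w) * n = (exp 1 * lam * w * n) * w := by ring
      have e' : exp 1 * (lam : ℝ) * w * (r * n) = (exp 1 * lam * w * n) * r := by ring
      rw [e, e']
      exact mul_le_mul_of_nonneg_left hwr (by positivity)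
    calc _ ≤ (exp 1 * M / r) ^ r * (((w : ℝ) * w) ^ r * ((n : ℝ) * n) ^ (M - r)) :=
          mul_le_mul_of_nonneg_right hC (by positivity)
      _ = ((n : ℝ) * n) ^ M * (exp 1 * lam * (w * w) / (r * n)) ^ r := e1
      _ ≤ ((n : ℝ) * n) ^ M * (exp 1 * lam * w / n) ^ r := by
          gcongr
  -- split `r = w + (q+1)` and bound the tail by `ρ^{q+1} ≤ (ρ^η)^w`
  have hbase1 : exp 1 * lam * w / n ≤ ρ := by
    rw [hρdef, div_le_div_iff₀ hnpos hsqrt]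
    calc exp 1 * lam * w * Real.sqrt n = (exp 1 * lam * Real.sqrt n) * w := by ring
      _ ≤ (exp 1 * lam * Real.sqrt n) * Real.sqrt n := mul_le_mul_of_nonneg_left hWn (by positivity)
      _ = exp 1 * lam * n := by rw [mul_assoc, hsq]
  have hbase0 : 0 ≤ exp 1 * lam * w / n := by positivity
  have htail : (exp 1 * lam * w / n) ^ (q + 1) ≤ (ρ ^ η) ^ w := by
    calc (exp 1 * lam * w / n) ^ (q + 1) ≤ ρ ^ (q + 1) := pow_le_pow_left₀ hbase0 hbase1 _
      _ = ρ ^ (((q + 1 : ℕ) : ℝ)) := (Real.rpow_natCast ρ (q + 1)).symm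
      _ ≤ ρ ^ (η * w) := by
          refine Real.rpow_le_rpow_of_exponent_ge hρpos hρ1 ?_
          have : η * w < (q : ℝ) + 1 := by rw [hq]; exact Nat.lt_floor_add_one _
          push_cast; linarith
      _ = (ρ ^ η) ^ w := by rw [Real.rpow_mul hρpos.le, Real.rpow_natCast]
  calc _ ≤ ((n : ℝ) * n) ^ M * (exp 1 * lam * w / n) ^ r := step1
    _ = ((n : ℝ) * n) ^ M * ((exp 1 * lam * w / n) ^ w * (exp 1 * lam * w / n) ^ (q + 1)) := by
        rw [hrq, ← pow_add]; ring_nf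
    _ ≤ ((n : ℝ) * n) ^ M * ((exp 1 * lam * w / n) ^ w * (ρ ^ η) ^ w) := by
        gcongr

/-- **The local density sum is small**: `Σ_{|W| ≤ K} C(M,r)(|W|²)^r(n²)^{M−r} ≤ (n²)^M/8` when
`K ≤ √n`, `eλ ≤ √n` and `e²λρ^η ≤ 1/16`. [cite: AroraBollobasLovaszTourlakis2006, Lemma 2.8 proof (p. 27)] -/
theorem dense_sum_le {lam K : ℕ} {η : ℝ} (hη0 : 0 ≤ η) (hM : M = lam * n) (hn : 1 ≤ n) (hlam : 1 ≤ lam)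
    (hρ : exp 1 * lam ≤ Real.sqrt n) (hK : (K : ℝ) ≤ Real.sqrt n)
    (hsmall : exp 1 ^ 2 * lam * (exp 1 * lam / Real.sqrt n) ^ η ≤ 1 / 16) :
    (∑ W ∈ smallSets n K, (M.choose (rThr η W) *
        ((W.card * W.card) ^ (rThr η W) * (n * n) ^ (M - rThr η W)) : ℝ)) ≤ ((n * n : ℕ) : ℝ) ^ M / 8 := by
  classical
  set N : ℝ := ((n : ℝ) * n) ^ M with hN
  have hNn : ((n * n : ℕ) : ℝ) ^ M = N := by rw [hN]; push_cast; ring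
  rw [hNn]
  have hnpos : (0 : ℝ) < n := by exact_mod_cast (by omega : 0 < n)
  have hNpos : 0 ≤ N := by rw [hN]; positivity
  set θ : ℝ := exp 1 ^ 2 * lam * (exp 1 * lam / Real.sqrt n) ^ η with hθ
  have hθ0 : 0 ≤ θ := by rw [hθ]; positivity
  -- the term of `W` is at most `N θ^{|W|} / C(n,|W|)`-summed: bound fiberwise by cardinality
  set T : Finset (Fin n) → ℝ := fun W => (M.choose (rThr η W) : ℝ) *
      (((W.card : ℝ) * W.card) ^ (rThr η W) * ((n : ℝ) * n) ^ (M - rThr η W)) with hT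
  have hT0 : ∀ W, 0 ≤ T W := fun W => by rw [hT]; positivity
  -- per-`W` bound for nonempty `W`
  have hTW : ∀ W ∈ smallSets n K, T W ≤ if W.card = 0 then 0 else
      N * ((exp 1 * lam * W.card / n) ^ W.card * ((exp 1 * lam / Real.sqrt n) ^ η) ^ W.card) := by
    intro W hW
    have hWK : W.card ≤ K := (mem_filter.1 hW).2
    split_ifs with h0
    · -- `W = ∅`: `r = 1` and the factor `0^1` vanishes
      rw [hT]; simp only
      rw [h0]; unfold rThr; simp
    · have hW1 : 1 ≤ W.card := by omega
      have hWn : (W.card : ℝ) ≤ Real.sqrt n := le_trans (by exact_mod_cast hWK) hK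
      exact dense_term_le hη0 hM hn hlam hρ W hW1 hWn
  -- sum fiberwise over the cardinality
  have hmaps : ∀ W ∈ smallSets n K, W.card ∈ range (K + 1) := fun W hW =>
    mem_range.2 (by have := (mem_filter.1 hW).2; omega)
  rw [← Finset.sum_fiberwise_of_maps_to hmaps]
  have hfiber : ∀ w ∈ range (K + 1),
      ∑ W ∈ (smallSets n K).filter (fun W => W.card = w), T W ≤ N * θ ^ w * (if w = 0 then 0 else 1) := by
    intro w hw
    by_cases h0 : w = 0
    · subst h0
      simp only [if_true, mul_zero]
      refine (sum_le_sum fun W hW => hTW W (mem_filter.1 hW).1).trans ?_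
      rw [sum_ite]; simp only [sum_const_zero, zero_add]
      refine le_of_eq (sum_eq_zero fun W hW => ?_)
      exfalso
      have h1 := (mem_filter.1 (mem_filter.1 hW).1).2
      exact (mem_filter.1 hW).2 h1
    · rw [if_neg h0, mul_one]
      have hw1 : 1 ≤ w := by omega
      -- each term ≤ N g(w), and there are ≤ C(n,w) of them
      set g : ℝ := N * ((exp 1 * lam * w / n) ^ w * ((exp 1 * lam / Real.sqrt n) ^ η) ^ w) with hg
      have hle : ∀ W ∈ (smallSets n K).filter (fun W => W.card = w), T W ≤ g := by
        intro W hW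
        obtain ⟨hWs, hWc⟩ := mem_filter.1 hW
        have := hTW W hWs
        rw [hWc, if_neg h0] at this
        rw [hg]; exact this
      have hcardfib : (((smallSets n K).filter (fun W => W.card = w)).card : ℝ) ≤ (n.choose w : ℝ) := by
        have : (smallSets n K).filter (fun W => W.card = w) ⊆ powersetCard w (univ : Finset (Fin n)) := by
          intro W hW
          exact mem_powersetCard.2 ⟨subset_univ _, (mem_filter.1 hW).2⟩
        have h := card_le_card this
        rw [card_powersetCard, card_univ, Fintype.card_fin] at h
        exact_mod_cast h
      have hg0 : 0 ≤ g := by rw [hg]; positivity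
      calc ∑ W ∈ (smallSets n K).filter (fun W => W.card = w), T W
          ≤ ∑ _W ∈ (smallSets n K).filter (fun W => W.card = w), g := sum_le_sum hle
        _ = (((smallSets n K).filter (fun W => W.card = w)).card : ℝ) * g := by rw [sum_const, nsmul_eq_mul]
        _ ≤ (n.choose w : ℝ) * g := mul_le_mul_of_nonneg_right hcardfib hg0
        _ ≤ N * θ ^ w := by
            -- `C(n,w) (eλw/n)^w ≤ (en/w)^w (eλw/n)^w = (e²λ)^w`
            have hC := choose_le_exp_pow n hw1
            have hwpos : (0 : ℝ) < w := by exact_mod_cast hw1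
            have e1 : (exp 1 * n / w) ^ w * (exp 1 * lam * w / n) ^ w = (exp 1 ^ 2 * lam) ^ w := by
              rw [← mul_pow]; congr 1; field_simp
            rw [hg, hθ, mul_pow, ← e1]
            have : (n.choose w : ℝ) * (N * ((exp 1 * lam * w / n) ^ w * ((exp 1 * lam / Real.sqrt n) ^ η) ^ w)) =
                N * ((n.choose w : ℝ) * (exp 1 * lam * w / n) ^ w * ((exp 1 * lam / Real.sqrt n) ^ η) ^ w) := by ring
            rw [this]
            have : N * ((exp 1 * ↑n / ↑w) ^ w * (exp 1 * ↑lam * ↑w / ↑n) ^ w * ((exp 1 * ↑lam / √↑n) ^ η) ^ w) =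
                N * ((exp 1 * ↑n / ↑w) ^ w * (exp 1 * ↑lam * ↑w / ↑n) ^ w * ((exp 1 * ↑lam / √↑n) ^ η) ^ w) := rfl
            gcongr
  calc ∑ w ∈ range (K + 1), ∑ W ∈ (smallSets n K).filter (fun W => W.card = w), T W
      ≤ ∑ w ∈ range (K + 1), N * θ ^ w * (if w = 0 then 0 else 1) := sum_le_sum hfiber
    _ ≤ ∑ w ∈ range (K + 1), N * (1 / 16) ^ w * (if w = 0 then 0 else 1) := by
        refine sum_le_sum fun w _ => ?_
        split_ifs
        · simp
        · rw [mul_one, mul_one]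
          exact mul_le_mul_of_nonneg_left (pow_le_pow_left₀ hθ0 hsmall w) hNpos
    _ = N * ∑ w ∈ range (K + 1), (1 / 16 : ℝ) ^ w * (if w = 0 then 0 else 1) := by
        rw [Finset.mul_sum]; exact sum_congr rfl fun w _ => by ring
    _ ≤ N * (1 / 8) := by
        refine mul_le_mul_of_nonneg_left ?_ hNpos
        -- geometric tail: `Σ_{w ≥ 1} 16^{-w} ≤ 1/15 ≤ 1/8`
        have hgeom : ∑ w ∈ range (K + 1), (1 / 16 : ℝ) ^ w * (if w = 0 then 0 else 1) ≤
            ∑ w ∈ range (K + 1), (1 / 16 : ℝ) ^ w - 1 := by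
          rw [Finset.sum_range_succ' (fun w => (1 / 16 : ℝ) ^ w)]
          rw [Finset.sum_range_succ']
          simp only [if_true, mul_zero, add_zero, pow_zero, Nat.succ_ne_zero, if_false, mul_one]
          linarith
        have hg2 : ∑ w ∈ range (K + 1), (1 / 16 : ℝ) ^ w ≤ 16 / 15 := by
          have := geom_sum_Ico_le_of_lt_one (by norm_num : (0:ℝ) ≤ 1/16) (by norm_num : (1/16 : ℝ) < 1) (m := 0) (n := K + 1)
          simp only [Finset.range_eq_Ico] at this ⊢
          refine this.trans ?_
          norm_num
        linarith
    _ = N / 8 := by ring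

/-! ### The parameters and the limit `n → ∞` -/

set_option maxHeartbeats 800000 in
/-- **The CMM gap graphs exist** (the statement of `CharikarMakarychevMakarychev2009_gapGraphs`):
for every `ε > 0` there are `∆`, `c > 0` and `n₀` such that for all `n ≥ n₀` some loopless
nonempty edge set on `n` vertices has maximum degree `≤ ∆`, all cuts `≤ (1/2+ε)|E|`, and all
sub-edge-sets on `≤ √n` vertices `⌊c log n⌋`-path decomposable.  Parameters: `ε₁ = min(ε,1)`,
`λ = ⌈16/ε₁²⌉`, `M = λn` random pairs, `∆ = ⌈512(2+4λ)/ε₁⌉ + 1`, `c = 1/(24(A+1))` with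
`A = log(16e³λ²)`. [cite: CharikarMakarychevMakarychev2009, §5 (p. 10–11); AroraBollobasLovaszTourlakis2006, Lemma 2.8 and Lemma 2.12] -/
theorem exists_gapGraphs :
    ∀ ε : ℝ, 0 < ε → ∃ Δ : ℕ, ∃ c : ℝ, 0 < c ∧ ∃ n₀ : ℕ, ∀ n : ℕ, n₀ ≤ n →
      ∃ E : Finset (Sym2 (Fin n)), E.Nonempty ∧ (∀ e ∈ E, ¬ e.IsDiag) ∧
        (∀ v : Fin n, (E.filter fun e => v ∈ e).card ≤ Δ) ∧
        (∀ x : Fin n → Bool, ∑ e ∈ E, cutFn e x ≤ (1 / 2 + ε) * E.card) ∧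
        (∀ E' ⊆ E, ((Multicut.supp E').card : ℝ) ^ 2 ≤ n →
          Multicut.PathDecomposable ⌊c * Real.log n⌋₊ E') := by
  intro ε hε
  -- constants
  set ε₁ : ℝ := min ε 1 with hε₁
  have hε₁0 : 0 < ε₁ := lt_min hε one_pos
  have hε₁1 : ε₁ ≤ 1 := min_le_right _ _
  have hε₁ε : ε₁ ≤ ε := min_le_left _ _
  set lam : ℕ := ⌈16 / ε₁ ^ 2⌉₊ with hlamdef
  have hlam16 : 16 ≤ ε₁ ^ 2 * lam := by
    have h : 16 / ε₁ ^ 2 ≤ (lam : ℝ) := Nat.le_ceil _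
    have hε2 : 0 < ε₁ ^ 2 := by positivity
    calc (16 : ℝ) = ε₁ ^ 2 * (16 / ε₁ ^ 2) := by field_simp
      _ ≤ ε₁ ^ 2 * lam := mul_le_mul_of_nonneg_left h hε2.le
  have hlam1r : (1 : ℝ) ≤ lam := by
    have h1 : ε₁ ^ 2 ≤ 1 := by nlinarith
    have h2 : ε₁ ^ 2 * lam ≤ 1 * lam := mul_le_mul_of_nonneg_right h1 (Nat.cast_nonneg _)
    linarith
  have hlam : 1 ≤ lam := by exact_mod_cast hlam1r
  have hlam0 : (0 : ℝ) < lam := by linarith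
  set D : ℕ := ⌈512 * (2 + 4 * (lam : ℝ)) / ε₁⌉₊ + 1 with hDdef
  have hD : 512 * (2 + 4 * (lam : ℝ)) ≤ D * ε₁ := by
    have h : 512 * (2 + 4 * (lam : ℝ)) / ε₁ ≤ (⌈512 * (2 + 4 * (lam : ℝ)) / ε₁⌉₊ : ℝ) := Nat.le_ceil _
    have h' : (⌈512 * (2 + 4 * (lam : ℝ)) / ε₁⌉₊ : ℝ) ≤ D := by rw [hDdef]; push_cast; linarith
    calc 512 * (2 + 4 * (lam : ℝ)) = 512 * (2 + 4 * (lam : ℝ)) / ε₁ * ε₁ := by field_simp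
      _ ≤ D * ε₁ := mul_le_mul_of_nonneg_right (h.trans h') hε₁0.le
  have hD1 : 1 ≤ D := by rw [hDdef]; omega
  set Bc : ℝ := exp 1 ^ 2 * lam with hBc
  set A : ℝ := Real.log (16 * Bc * (exp 1 * lam)) with hA
  have he1 : 1 ≤ exp (1 : ℝ) := by have := Real.add_one_le_exp (1:ℝ); linarith
  have helam : 1 ≤ exp 1 * (lam : ℝ) := by nlinarith
  have hBc1 : 1 ≤ Bc := by rw [hBc]; nlinarith
  have hA0 : 0 ≤ A := by rw [hA]; exact Real.log_nonneg (by nlinarith)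
  have hA2lam : Real.log (2 * lam) ≤ A := by
    rw [hA]; refine Real.log_le_log (by positivity) ?_; nlinarith
  set c : ℝ := 1 / (24 * (A + 1)) with hc
  have hc0 : 0 < c := by rw [hc]; positivity
  have hc1 : c ≤ 1 := by rw [hc, div_le_one (by positivity)]; linarith
  have hcA : c * Real.log (2 * lam) ≤ 1 / 4 := by
    calc c * Real.log (2 * lam) ≤ c * A := mul_le_mul_of_nonneg_left hA2lam hc0.le
      _ = A / (24 * (A + 1)) := by rw [hc]; ring
      _ ≤ 1 / 4 := by rw [div_le_div_iff₀ (by positivity) (by norm_num)]; linarith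
  refine ⟨D, c, hc0, ?_⟩
  -- eventual conditions in `n`
  have hnat : Tendsto (fun k : ℕ => (k : ℝ)) atTop atTop := tendsto_natCast_atTop_atTop
  have hlog : Tendsto (fun k : ℕ => Real.log (k : ℝ)) atTop atTop := Real.tendsto_log_atTop.comp hnat
  have ev1 : ∀ᶠ k : ℕ in atTop, 2 ≤ k := eventually_ge_atTop 2
  have ev2 : ∀ᶠ k : ℕ in atTop, 32 * (8 * (lam : ℝ) + 16 * lam ^ 2) / (ε₁ * lam) ≤ (k : ℝ) :=
    hnat.eventually_ge_atTop _
  have ev3 : ∀ᶠ k : ℕ in atTop, (41472 / (ε₁ * lam)) ^ 2 ≤ (k : ℝ) := hnat.eventually_ge_atTop _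
  have ev4 : ∀ᶠ k : ℕ in atTop, (exp 1 * lam) ^ 2 ≤ (k : ℝ) := hnat.eventually_ge_atTop _
  have ev5 : ∀ᶠ k : ℕ in atTop, 56 * A ≤ Real.log (k : ℝ) := hlog.eventually_ge_atTop _
  obtain ⟨n₀, hn₀⟩ := eventually_atTop.1 (ev1.and (ev2.and (ev3.and (ev4.and ev5))))
  refine ⟨n₀, fun n hn => ?_⟩
  obtain ⟨h2n, h2, h3, h4, h5⟩ := hn₀ n hn
  have hn1 : 1 ≤ n := by omega
  have hnpos : (0 : ℝ) < n := by exact_mod_cast (by omega : 0 < n)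
  have hn1r : (1 : ℝ) ≤ n := by exact_mod_cast hn1
  have hlogn0 : 0 ≤ Real.log n := Real.log_nonneg hn1r
  -- `n`-dependent parameters
  set l : ℕ := ⌊c * Real.log n⌋₊ with hl
  set η : ℝ := 1 / (6 * l + 14) with hη
  set K : ℕ := ⌊Real.sqrt n⌋₊ with hK
  have hη0 : 0 ≤ η := by rw [hη]; positivity
  have hη1 : η ≤ 1 := by rw [hη, div_le_one (by positivity)]; have : (0:ℝ) ≤ l := Nat.cast_nonneg _; linarith
  have hlle : (l : ℝ) ≤ c * Real.log n := Nat.floor_le (mul_nonneg hc0.le hlogn0)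
  have hsqrtpos : 0 < Real.sqrt n := Real.sqrt_pos.2 hnpos
  have hsq : Real.sqrt n * Real.sqrt n = n := Real.mul_self_sqrt hnpos.le
  -- (a) `eλ ≤ √n`
  have hρ : exp 1 * lam ≤ Real.sqrt n := (Real.le_sqrt (by positivity) hnpos.le).2 h4
  -- (b) `32(8λ+16λ²) ≤ ε₁ λ n`
  have hsmall : 32 * (8 * (lam : ℝ) + 16 * lam ^ 2) ≤ ε₁ * ((lam * n : ℕ) : ℝ) := by
    push_cast
    have := (div_le_iff₀ (by positivity : (0:ℝ) < ε₁ * lam)).1 h2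
    linarith
  -- (c) `512 (l+1)² (2λ)^l ≤ ε₁ λ n`
  have hcyc : 512 * ((l : ℝ) + 1) ^ 2 * (2 * lam) ^ l ≤ ε₁ * lam * n := by
    -- `(l+1)² ≤ 81 n^{1/4}`
    have hn8 : 1 ≤ (n : ℝ) ^ (1 / 8 : ℝ) := Real.one_le_rpow hn1r (by norm_num)
    have hlog8 : Real.log n ≤ 8 * (n : ℝ) ^ (1 / 8 : ℝ) := by
      have := Real.log_le_rpow_div hnpos.le (by norm_num : (0:ℝ) < 1 / 8)
      linarith [show (n : ℝ) ^ (1 / 8 : ℝ) / (1 / 8) = 8 * (n : ℝ) ^ (1 / 8 : ℝ) by ring]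
    have hl1 : (l : ℝ) + 1 ≤ 9 * (n : ℝ) ^ (1 / 8 : ℝ) := by
      have : (l : ℝ) ≤ Real.log n := hlle.trans (mul_le_of_le_one_left hlogn0 hc1)
      linarith
    have hsq8 : ((n : ℝ) ^ (1 / 8 : ℝ)) ^ 2 = (n : ℝ) ^ (1 / 4 : ℝ) := by
      rw [← Real.rpow_natCast, ← Real.rpow_mul hnpos.le]; norm_num
    have hA1 : ((l : ℝ) + 1) ^ 2 ≤ 81 * (n : ℝ) ^ (1 / 4 : ℝ) := by
      calc ((l : ℝ) + 1) ^ 2 ≤ (9 * (n : ℝ) ^ (1 / 8 : ℝ)) ^ 2 :=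
            pow_le_pow_left₀ (by positivity) hl1 2
        _ = 81 * (n : ℝ) ^ (1 / 4 : ℝ) := by rw [mul_pow, hsq8]; norm_num
    -- `(2λ)^l ≤ n^{1/4}`
    have h2lam : (1 : ℝ) ≤ 2 * lam := by linarith
    have hB1 : (2 * (lam : ℝ)) ^ l ≤ (n : ℝ) ^ (1 / 4 : ℝ) := by
      calc (2 * (lam : ℝ)) ^ l = (2 * (lam : ℝ)) ^ ((l : ℕ) : ℝ) := (Real.rpow_natCast _ _).symm
        _ ≤ (2 * (lam : ℝ)) ^ (c * Real.log n) := Real.rpow_le_rpow_of_exponent_le h2lam hlle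
        _ = Real.exp (c * Real.log n * Real.log (2 * lam)) := by
            rw [Real.rpow_def_of_pos (by positivity), mul_comm]
        _ ≤ Real.exp (Real.log n * (1 / 4)) := by
            rw [Real.exp_le_exp]
            have : c * Real.log n * Real.log (2 * lam) = Real.log n * (c * Real.log (2 * lam)) := by ring
            rw [this]
            exact mul_le_mul_of_nonneg_left hcA hlogn0
        _ = (n : ℝ) ^ (1 / 4 : ℝ) := by rw [Real.rpow_def_of_pos hnpos]
    have hquarter : (n : ℝ) ^ (1 / 4 : ℝ) * (n : ℝ) ^ (1 / 4 : ℝ) = Real.sqrt n := by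
      rw [← Real.rpow_add hnpos, Real.sqrt_eq_rpow]; norm_num
    -- `√n ≥ 41472/(ε₁ λ)`
    have hsqrtge : 41472 / (ε₁ * lam) ≤ Real.sqrt n := (Real.le_sqrt (by positivity) hnpos.le).2 h3
    have h41472 : 41472 * Real.sqrt n ≤ ε₁ * lam * n := by
      have := (div_le_iff₀ (by positivity : (0:ℝ) < ε₁ * lam)).1 hsqrtge
      calc 41472 * Real.sqrt n ≤ (Real.sqrt n * (ε₁ * lam)) * Real.sqrt n :=
            mul_le_mul_of_nonneg_right this hsqrtpos.le
        _ = ε₁ * lam * n := by rw [mul_comm (Real.sqrt n), mul_assoc, hsq]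
    calc 512 * ((l : ℝ) + 1) ^ 2 * (2 * lam) ^ l ≤ 512 * (81 * (n : ℝ) ^ (1 / 4 : ℝ)) * (n : ℝ) ^ (1 / 4 : ℝ) := by
          gcongr
      _ = 41472 * Real.sqrt n := by rw [← hquarter]; ring
      _ ≤ ε₁ * lam * n := h41472
  -- (d) `l ≤ M`
  have hlog_le : c * Real.log n ≤ Real.log n := mul_le_of_le_one_left hlogn0 hc1
  have hlM : l ≤ lam * n := by
    have h1 : (l : ℝ) ≤ Real.log n := hlle.trans hlog_le
    have h2 : Real.log n ≤ n := (Real.log_le_sub_one_of_pos hnpos).trans (by linarith)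
    have h3 : (n : ℝ) ≤ lam * n := le_mul_of_one_le_left hnpos.le hlam1r
    exact_mod_cast (h1.trans (h2.trans h3))
  -- (e) the density decay: `e²λ ρ^η ≤ 1/16`
  have hdecay : exp 1 ^ 2 * lam * (exp 1 * lam / Real.sqrt n) ^ η ≤ 1 / 16 := by
    have hρpos : 0 < exp 1 * lam / Real.sqrt n := by positivity
    -- `(η/2) log n ≥ A`
    have hηlog : A ≤ η / 2 * Real.log n := by
      -- `log n ≥ 2A(6 c log n + 14)` from `log n ≥ 56A` and `12Ac ≤ 1/2`
      have h12 : 12 * A * c ≤ 1 / 2 := by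
        have hA1 : (0 : ℝ) < A + 1 := by linarith
        rw [hc, show 12 * A * (1 / (24 * (A + 1))) = A / (2 * (A + 1)) by field_simp; ring]
        rw [div_le_iff₀ (by positivity)]; linarith
      have hkey : 2 * A * (6 * c * Real.log n + 14) ≤ Real.log n := by
        have h' : 12 * A * c * Real.log n ≤ 1 / 2 * Real.log n := mul_le_mul_of_nonneg_right h12 hlogn0
        have e : 2 * A * (6 * c * Real.log n + 14) = 12 * A * c * Real.log n + 28 * A := by ring
        rw [e]; linarith
      have hden : (0 : ℝ) < 6 * l + 14 := by positivity
      rw [hη]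
      rw [show 1 / (6 * (l : ℝ) + 14) / 2 * Real.log n = Real.log n / (2 * (6 * l + 14)) by
        field_simp]
      rw [le_div_iff₀ (by positivity)]
      calc A * (2 * (6 * (l : ℝ) + 14)) ≤ A * (2 * (6 * (c * Real.log n) + 14)) := by
            gcongr
        _ = 2 * A * (6 * c * Real.log n + 14) := by ring
        _ ≤ Real.log n := hkey
    -- `e²λ ρ^η = exp(log(e²λ) + η log ρ)` and `log ρ = log(eλ) − (log n)/2`
    have hlogρ : Real.log (exp 1 * lam / Real.sqrt n) = Real.log (exp 1 * lam) - Real.log n / 2 := by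
      rw [Real.log_div (by positivity) hsqrtpos.ne', Real.log_sqrt hnpos.le]
    have hexpr : exp 1 ^ 2 * lam * (exp 1 * lam / Real.sqrt n) ^ η =
        Real.exp (Real.log Bc + (Real.log (exp 1 * lam) - Real.log n / 2) * η) := by
      rw [Real.exp_add, Real.exp_log (by positivity), Real.rpow_def_of_pos hρpos, hlogρ, ← hBc]
    rw [hexpr]
    have h16 : (1 / 16 : ℝ) = Real.exp (-Real.log 16) := by rw [Real.exp_neg, Real.exp_log (by norm_num)]; norm_num
    rw [h16, Real.exp_le_exp]
    -- `log Bc + η log(eλ) − (η/2) log n ≤ −log 16` since `A = log 16 + log Bc + log(eλ) ≤ (η/2) log n`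
    have hAexp : A = Real.log 16 + Real.log Bc + Real.log (exp 1 * lam) := by
      rw [hA, Real.log_mul (by positivity) (by positivity), Real.log_mul (by norm_num) (by positivity)]
    have hlogel : 0 ≤ Real.log (exp 1 * lam) := Real.log_nonneg helam
    have : η * Real.log (exp 1 * lam) ≤ Real.log (exp 1 * lam) := mul_le_of_le_one_left hlogel hη1
    have e : Real.log Bc + (Real.log (exp 1 * lam) - Real.log n / 2) * η =
        Real.log Bc + η * Real.log (exp 1 * lam) - η / 2 * Real.log n := by ring
    rw [e]; linarith
  -- the good outcome and its pruned edge set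
  have hKle : (K : ℝ) ≤ Real.sqrt n := Nat.floor_le hsqrtpos.le
  have hdense := dense_sum_le (M := lam * n) (K := K) hη0 rfl hn1 hlam hρ hKle hdecay
  obtain ⟨ω, hω⟩ := exists_good (n := n) (M := lam * n) (K := K) (η := η) (D := D) (l := l)
    hε₁0 h2n rfl hlam hlam16 hD hcyc hlM hdense
  obtain ⟨hne, hloop, hdeg, hcut, hPD⟩ := good_props (ε := ε) hε₁0 hε₁1 hε₁ε rfl hn1 hlam hD1 hsmall hη
    (by rw [hK]) hω
  exact ⟨pruned D l ω, hne, hloop, hdeg, hcut, hPD⟩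

end RandomPairs

end Literature.Combinatorics.Optimization
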